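import Literature.AnabelianGeometry.EtaleTheta.BiKummerOfModelCanonical
import Literature.AnabelianGeometry.EtaleTheta.Discharge.Sec5RootCompositionModel
import Literature.AnabelianGeometry.EtaleTheta.BiKummerRootTwist
import Literature.AlgebraicGeometry.Frobenioids.ModelFrobenioidPreSteps

/-!
# [EtTh] Rmk. 4.3.2: the pull-back-factor compatibility (B1′) of `NthRoot.rebase` HOLDS at the canonical model, from the
# base-level square `Base(α_{1,N}) ≫ Base(α_1) = Base(α_N)` alone — for ANY Def. 4.1 (iv) datum of the transition

S. Mochizuki, *The étale theta function and its Frobenioid-theoretic manifestations*, Publ. RIMS **45** (2009)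
[cite: MochizukiEtTh2009, Rmk 4.3.2 p.318–319 (PDF pp.92–93); Prop 4.2 (iii) p.314 (PDF p.88); Def 4.1 (iv) p.313 (PDF p.87)];
S. Mochizuki, *The geometry of Frobenioids I* (2008), Prop. 1.11 (iv) (functoriality of `(−)^birat`).

abc-iut cell, layer L2, row R219 FINAL KNIT (holder abc-iut-L2-d4 g5; FILE 2 PROPER abc-iut-w5-d245 g4), seat abc-iut-f-121 (gen 2).
PROOF-ONLY companion of `BiKummerRootRebase.lean` (p443132: `NthRoot.rebase … (D : S.BaseFrobeniusTypeData a)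
(hD : pullFrac D.α₁ R₁.root = pullFrac R.αData.α₁ f)`), over abc-iut-L2-t9's canonical model `mkOfModelCanonical` and
abc-iut-w5-d134's `pullFracModel` laws (`Discharge/Sec5RootCompositionModel.lean`: `pullFracModel_eq_of_baseMap_eq`,
`pullFracModel_comp_apply`, `NthRoot.baseMap_α_eq`).

WHAT IS PROVED.  For roots typed over ANY rendering `pullFrac` of the birational pull-back that agrees with
`pullFracModel = B(Base −)` (`hF`), an `N`-th root `R` and a first root `R₁` of the same fraction-pair of `f`, a transition
`a = α_{1,N} : A_N → A_1` and ANY Def. 4.1 (iv) datum `D` of `a`: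
* `NthRoot.root_eq_pullFrac_of_one` — a FIRST root's root element is `f|_{A_1} = (α′_1)^* f` (generic setting; `f_1^1 = f_1`);
* **`NthRoot.rebase_hD_of_baseMap_eq`** — if `Base(a) ≫ Base(α_1) = Base(α_N)` then `(D.α₁)^* f_1 = (α′_N)^* f`, i.e. the binder
  `hD` of `NthRoot.rebase` HOLDS: `((−)^birat)^*` depends only on `Base` ([FrdI] Prop. 1.11 (iv)), `Base(D.α₁) = Base(a)` and
  `Base(α′) = Base(α)` because the Frobenius parts `α″` are base-identity (Def. 4.1 (iv)(c)), and `B` is a functor;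
* `NthRoot.rebase_hD_of_comp` — the same from the square `a ≫ α_1 = α_N` in `C` (abc-iut-L2-d4's `hαover`).
* (v2) `pullFrac_comp_of_rendering` — the binder `hpull₂` under `hF`; **`FractionPair.hf_of_normalisedAnchor`** — the anchor's
  birational clause `hf : (eA)^* f′ = ψ_A f` of p438241 HOLDS for every NORMALISED anchor (from Thm. 4.4 (ii) `hii` and
  `hnum`/`hden` by [FrdI] Thm. 5.2 (ii): `frac_comp_of_degFr_eq_one`, `coe_frac_comp_left`).
So, at the genuine towers (whose settings unfold to `mkOfModelCanonical`), of the two inputs (B1)/(B1′) of `rebase` only the CHOICE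
of a datum `D_N ∈ BaseFrobeniusTypeData (α (one_dvd_level N))` remains — any witness of the tower field `baseFrob_α` will do —
and abc-iut-L2-d4's «pow_root/isSaturated rewritten along hαover» is literally true there.
HONEST FRAMING: kernel-checked identities in the model vocabulary; refereed pre-IUT material; nothing here bears on [IUTchIII]
Cor. 3.12 or takes a side; typed ≠ proved for any genuine datum.
-/

namespace Literature.AnabelianGeometry.EtaleTheta

open CategoryTheory Opposite Literature.AlgebraicGeometry.Frobenioids

namespace BiKummerSetting

universe u₀ v₀ u v w

/-! ### §1. A first root's root element (generic setting) -/

section Generic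

variable {K : Type u₀} [Field K] {X : SemiGraphs.TemperedArithmeticGroup.{u₀} K} {D₀ : Type u₀} [Category.{v₀} D₀]
  {V : FrdIMonoidStub.{w}} {T : RealifiedDivisorMonoids (D₀ := D₀) V} {D : Type u} [Category.{v} D]
  {VD : FrdICatStub.{u, v, w} D} {S : BiKummerSetting X T D VD}
  {pullFrac : ∀ {A A' : S.C} (_ : A' ⟶ A), S.biratUnits A → S.biratUnits A'}

/-- **A first root's root element is `f|_{A_1} = (α′_1)^* f`** (`f_1^1 = f_1`, Prop. 4.2 (iii) with `N = 1`).
[cite: MochizukiEtTh2009, Prop 4.2 (iii) p.314 (PDF p.88)] -/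
theorem NthRoot.root_eq_pullFrac_of_one {A B : S.C} {f : S.biratUnits A} {P : S.FractionPair f B}
    (R₁ : S.NthRoot f P 1 pullFrac) : R₁.root = pullFrac R₁.αData.α₁ f := by
  have h := R₁.pow_root
  rwa [PNat.one_coe, pow_one] at h

end Generic

/-! ### §2. (B1′) at the canonical model from the base-level square -/

section Canonical

variable {K : Type u₀} [Field K] {D₀ : Type u₀} [Category.{v₀} D₀] {V : FrdIMonoidStub.{w}}
  (X : SemiGraphs.TemperedArithmeticGroup.{u₀} K) {T : RealifiedDivisorMonoids (D₀ := D₀) V}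
  {D : Type u} [Category.{v} D] {VD : FrdICatStub.{u, v, w} D}
  (tf : TemperedFrobenioid T D VD) (hZ : tf.monoidType = MonoidType.Z)
  (hP : ∀ A : Dᵒᵖ, IsPerfect (tf.Φ.carrier A)) (IG : D → Prop) (gS : ∀ A : D, IG A → (X.Pi →* Aut A))
  (gSs : ∀ (A : D) (h : IG A), Function.Surjective (gS A h))
  (NH : Subgroup (Field.absoluteGaloisGroup K) → tf.category → ℕ+ → Prop) (A₀ : tf.category)
  (hA₀ : PreFrobenioid.IsFrobeniusTrivial tf.toElem A₀) (hA₀' : IG A₀.base)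
  {pullFrac : ∀ {A A' : (mkOfModelCanonical X tf hZ hP IG gS gSs NH A₀ hA₀ hA₀').C} (_ : A' ⟶ A),
    (mkOfModelCanonical X tf hZ hP IG gS gSs NH A₀ hA₀ hA₀').biratUnits A →
      (mkOfModelCanonical X tf hZ hP IG gS gSs NH A₀ hA₀ hA₀').biratUnits A'}
  (hF : ∀ {A A' : (mkOfModelCanonical X tf hZ hP IG gS gSs NH A₀ hA₀ hA₀').C} (ψ : A' ⟶ A)
    (y : (mkOfModelCanonical X tf hZ hP IG gS gSs NH A₀ hA₀ hA₀').biratUnits A), pullFrac ψ y = tf.pullFracModel ψ y)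

/-- `Base(α′) = Base(α)` for a Def. 4.1 (iv) datum: the Frobenius part `α″` is base-identity.
[cite: MochizukiEtTh2009, Def 4.1 (iv) p.313 (PDF p.87)] -/
theorem BaseFrobeniusTypeData.baseMap_α₁_eq {A₁ A₂ : tf.category} (a : A₁ ⟶ A₂)
    (Da : (mkOfModelCanonical X tf hZ hP IG gS gSs NH A₀ hA₀ hA₀').BaseFrobeniusTypeData a) :
    ModelFrobenioid.baseMap Da.α₁ = ModelFrobenioid.baseMap a := by
  have hb : ModelFrobenioid.baseMap Da.α₂ = 𝟙 _ := Da.cond_c.1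
  -- `baseMap_comp` is `rfl`; stated by hand because `Da.fac` composes in the setting's copy of the category instance
  have h : ModelFrobenioid.baseMap Da.α₂ ≫ ModelFrobenioid.baseMap Da.α₁ = ModelFrobenioid.baseMap a :=
    congrArg ModelFrobenioid.baseMap Da.fac
  rw [hb, Category.id_comp] at h
  exact h

variable {A B : tf.category} {f : (mkOfModelCanonical X tf hZ hP IG gS gSs NH A₀ hA₀ hA₀').biratUnits A}
  {P : (mkOfModelCanonical X tf hZ hP IG gS gSs NH A₀ hA₀ hA₀').FractionPair f B} {N : ℕ+}
  (R : (mkOfModelCanonical X tf hZ hP IG gS gSs NH A₀ hA₀ hA₀').NthRoot f P N pullFrac)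
  (R₁ : (mkOfModelCanonical X tf hZ hP IG gS gSs NH A₀ hA₀ hA₀').NthRoot f P 1 pullFrac)
  (a : R.AN ⟶ R₁.AN) (Da : (mkOfModelCanonical X tf hZ hP IG gS gSs NH A₀ hA₀ hA₀').BaseFrobeniusTypeData a)

include hF in
/-- **(B1′) of `NthRoot.rebase` HOLDS at the canonical model from the base-level square**: if
`Base(α_{1,N}) ≫ Base(α_1) = Base(α_N)` then `(D.α₁)^* f_1 = (α′_N)^* f` for ANY Def. 4.1 (iv) datum `D` of `α_{1,N}` —
`((−)^birat)^* = B(Base −)` is functorial and blind to the base-identity Frobenius parts.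
[cite: MochizukiEtTh2009, Rmk 4.3.2 p.318–319 (PDF pp.92–93); Def 4.1 (iv) p.313 (PDF p.87)] -/
theorem NthRoot.rebase_hD_of_baseMap_eq
    (hbase : ModelFrobenioid.baseMap a ≫ ModelFrobenioid.baseMap R₁.α = ModelFrobenioid.baseMap R.α) :
    pullFrac Da.α₁ R₁.root = pullFrac R.αData.α₁ f := by
  rw [NthRoot.root_eq_pullFrac_of_one R₁]
  simp only [hF]
  rw [← tf.pullFracModel_comp_apply]
  refine DFunLike.congr_fun (tf.pullFracModel_eq_of_baseMap_eq ?_) f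
  rw [ModelFrobenioid.baseMap_comp, BaseFrobeniusTypeData.baseMap_α₁_eq X tf hZ hP IG gS gSs NH A₀ hA₀ hA₀' a Da,
    ← NthRoot.baseMap_α_eq R₁, hbase, NthRoot.baseMap_α_eq R]

include hF in
/-- **(B1′) of `NthRoot.rebase` from abc-iut-L2-d4's `hαover : α_{1,N} ≫ α_1 = α_N`** (the transitions lie over the base pair,
Rmk. 4.3.2).  [cite: MochizukiEtTh2009, Rmk 4.3.2 p.318–319 (PDF pp.92–93)] -/
theorem NthRoot.rebase_hD_of_comp (hαover : a ≫ R₁.α = R.α) : pullFrac Da.α₁ R₁.root = pullFrac R.αData.α₁ f :=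
  NthRoot.rebase_hD_of_baseMap_eq X tf hZ hP IG gS gSs NH A₀ hA₀ hA₀' hF R R₁ a Da
    (by rw [← ModelFrobenioid.baseMap_comp, hαover])

/-! ### §3. (v2) The two remaining RENDERING-level binders of p438241 at the model: `hpull₂` and the anchor's `hf` -/

include hF in
/-- **`hpull₂` under the rendering law**: `((φ ≫ χ)^birat)^* = (φ^birat)^* ∘ (χ^birat)^*` for any rendering `pullFrac` agreeing
with `pullFracModel` (abc-iut-w5-d134's `pullFracModel_comp_apply`). [cite: MochizukiEtTh2009, Prop 4.2 p.314 (PDF p.88)] -/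
theorem pullFrac_comp_of_rendering {A₁ A₂ A₃ : tf.category} (φ : A₁ ⟶ A₂) (χ : A₂ ⟶ A₃)
    (g : (mkOfModelCanonical X tf hZ hP IG gS gSs NH A₀ hA₀ hA₀').biratUnits A₃) :
    pullFrac (φ ≫ χ) g = pullFrac φ (pullFrac χ g) := by
  rw [hF, hF, hF]
  exact tf.pullFracModel_comp_apply φ χ g

include hF in
/-- **The anchor's birational clause `hf` of `NthRoot.transportAt` / `exists_unit_transport_twisted(_rebase)` HOLDS at the
canonical model for EVERY normalised anchor** — one instance per anchor `(eA, eB, u)`, not per level: if `Ψ` preserves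
fraction-pairs through `ψ = Ψ^birat` (Thm. 4.4 (ii), `hii`) and the anchor is normalised (`eA⁻¹ ≫ Ψ s′ ≫ eB = s′`,
`eA⁻¹ ≫ Ψ s″ ≫ eB = s″ ≫ u`), then `(eA)^* (s′·(u ∘ s″)⁻¹) = ψ_A (s′·(s″)⁻¹)`: `ψ_A f = Ψs′·(Ψs″)⁻¹ =
(eA ≫ s′ ≫ eB⁻¹)·(eA ≫ s″u ≫ eB⁻¹)⁻¹`, post-composition with the linear `eB⁻¹` drops out ([FrdI] Thm. 5.2 (ii),
`frac_comp_of_degFr_eq_one`) and pre-composition with `eA` is `Base(eA)^*` (`coe_frac_comp_left`).  So in abc-iut-L2-d4's `hfam`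
(∀ normalised anchor) the binder `hf` is PRODUCED from `hT₁`/`hT₁′`.
[cite: MochizukiEtTh2009, Thm 4.4 (ii) p.320 (PDF p.94); Def 4.1 (i) p.312 (PDF p.86); Thm 5.7 p.329 (PDF p.103)] -/
theorem FractionPair.hf_of_normalisedAnchor
    (h : Thm44Hyp (mkOfModelCanonical X tf hZ hP IG gS gSs NH A₀ hA₀ hA₀') (mkOfModelCanonical X tf hZ hP IG gS gSs NH A₀ hA₀ hA₀'))
    (ψ : ∀ A : (mkOfModelCanonical X tf hZ hP IG gS gSs NH A₀ hA₀ hA₀').C,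
      (mkOfModelCanonical X tf hZ hP IG gS gSs NH A₀ hA₀ hA₀').biratUnits A ≃*
        (mkOfModelCanonical X tf hZ hP IG gS gSs NH A₀ hA₀ hA₀').biratUnits (h.Ψ.functor.obj A))
    (hii : Thm44_ii h ψ) {A B : tf.category} {f : (mkOfModelCanonical X tf hZ hP IG gS gSs NH A₀ hA₀ hA₀').biratUnits A}
    (P : (mkOfModelCanonical X tf hZ hP IG gS gSs NH A₀ hA₀ hA₀').FractionPair f B) (u : Aut B)
    (hu : u ∈ (mkOfModelCanonical X tf hZ hP IG gS gSs NH A₀ hA₀ hA₀').units B)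
    {f' : (mkOfModelCanonical X tf hZ hP IG gS gSs NH A₀ hA₀ hA₀').biratUnits A}
    (hfrac : (mkOfModelCanonical X tf hZ hP IG gS gSs NH A₀ hA₀ hA₀').fracOf P.num (P.den ≫ u.hom) P.isPreStep_num
      (BiKummerSetting.isPreStep_comp_aut P.isPreStep_den u) (BiKummerSetting.baseEquivalent_comp_unit P.base_eq hu) = f')
    (eA : h.Ψ.functor.obj A ≅ A) (eB : h.Ψ.functor.obj B ≅ B)
    (hnum : eA.inv ≫ h.Ψ.functor.map P.num ≫ eB.hom = P.num)
    (hden : eA.inv ≫ h.Ψ.functor.map P.den ≫ eB.hom = P.den ≫ u.hom) :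
    pullFrac eA.hom f' = ψ A f := by
  obtain ⟨Q, hQn, hQd⟩ := hii f P
  have hQ : tf.fracOfModel T.isUnit_BΛ Q.num Q.den = ψ A f := Q.frac_eq
  have hn' : h.Ψ.functor.map P.num = (eA.hom ≫ P.num) ≫ eB.inv :=
    (Iso.eq_comp_inv eB).mpr ((Iso.inv_comp_eq eA).mp hnum)
  have hd' : h.Ψ.functor.map P.den = (eA.hom ≫ P.den ≫ u.hom) ≫ eB.inv :=
    (Iso.eq_comp_inv eB).mpr ((Iso.inv_comp_eq eA).mp hden)
  -- `Base(eA ≫ s′) = Base(eA ≫ s″ ≫ u)` and the degree bookkeeping ([FrdI] Thm 5.2 (ii))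
  have hbe : ModelFrobenioid.baseMap P.num = ModelFrobenioid.baseMap P.den := P.base_eq
  have hbu : ModelFrobenioid.baseMap u.hom = 𝟙 _ := hu.1
  have hb : ModelFrobenioid.baseMap (eA.hom ≫ P.num) = ModelFrobenioid.baseMap (eA.hom ≫ P.den ≫ u.hom) := by
    rw [ModelFrobenioid.baseMap_comp, ModelFrobenioid.baseMap_comp, ModelFrobenioid.baseMap_comp, hbu, Category.comp_id,
      hbe]
  have hlin : ModelFrobenioid.degFr eB.inv = 1 := PreFrobenioid.isLinear_of_isIso tf.toElem eB.inv
  have hdeg : ModelFrobenioid.degFr P.num = ModelFrobenioid.degFr (P.den ≫ u.hom) :=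
    (show ModelFrobenioid.degFr P.num = 1 from P.isPreStep_num.1).trans
      (show ModelFrobenioid.degFr (P.den ≫ u.hom) = 1 from (BiKummerSetting.isPreStep_comp_aut P.isPreStep_den u).1).symm
  rw [← hQ, hQn, hQd, hn', hd', ← hfrac, hF]
  show tf.pullFracModel eA.hom (tf.fracOfModel T.isUnit_BΛ P.num (P.den ≫ u.hom)) =
    tf.fracOfModel T.isUnit_BΛ ((eA.hom ≫ P.num) ≫ eB.inv) ((eA.hom ≫ P.den ≫ u.hom) ≫ eB.inv)
  unfold TemperedFrobenioid.fracOfModel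
  -- post-composition with the linear `eB⁻¹` drops out (term-mode: the two copies of the category instance are defeq, not
  -- reducibly so); pre-composition with `eA` is `Base(eA)^*`
  refine Eq.trans ?_ (ModelFrobenioid.frac_comp_of_degFr_eq_one _ (eA.hom ≫ P.num) (eA.hom ≫ P.den ≫ u.hom) hb hlin).symm
  apply Units.ext
  rw [TemperedFrobenioid.coe_pullFracModel_apply]
  exact (ModelFrobenioid.coe_frac_comp_left _ _ eA.hom P.num (P.den ≫ u.hom) hdeg).symm

end Canonical

end BiKummerSetting

end Literature.AnabelianGeometry.EtaleTheta
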